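import Mathlib
import HarnessLib
import HarnessLib.Audit
import Summits.KontsevichZagierPeriods.Statement

/-!
Route: PhiFourLaboratory

CLOSED (retired) 2026-08-15T13:48:36Z by operator:999:1257524 — reason: not-a-thesis: assembly does not conclude the sub-problem Statement — note: D-0027 §2.1 audit (human 2026-08-15: routes that do not decide the summit are removed): the assembly concludes `PhiFourSector`, not the sub-problem statement; a NEW conforming route may be opened from the same idea (generated `closes : … → _root_.KontsevichZagierPeriods`).. The file is kept as the record of this route; refuted decls are indexed as negative knowledge (`ledger negatives`).

# Route PhiFourLaboratory — The phi^4 laboratory — Feynman's dictionary as KZ moves, Hepp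
faithfulness and tropical lifting on the graph-period sector

SECTOR ROUTE realising idea card phi4-hepp-tropical-lifting (declared up front: the Target is
Conjecture 1 RESTRICTED to the
sector of parametric Feynman-graph period representations — a necessary special case of the summit,
`SectorOfSummit :
KontsevichZagierPeriods → PhiFourSector`, NOT claimed to imply it; the Assembly ends in the local
Target, as in the barrier-route
precedent). It suffices, for the sector, to show X := HeppForward ∧ TropicalLifting: (HeppForward,
Panzer Conj. 1.2 ⟹) two φ⁴
graphs (every vertex of degree ≤ 4) whose parametric representations ∫_(x>0) dx/Ψ_G(x,1)² have equal
value have equal Hepp bounds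
H(G) ∈ ℚ — the tropicalisation of the period, inlined by Panzer's bridgeless-flag formula (Prop.
3.2) over the edge list, with
loops(γ) = |γ| − rank_ℚ(incidence|γ); and (TropicalLifting, Conj. 1.2 ⟸ thickened from "equal value"
to "move chain") equal Hepp
bounds force `KZ.Equivalent` of the two representations. The LABORATORY half makes Feynman's
dictionary rule-internal:
PositionIsParametric (Schnetz's affine position-space representation ~ π^(2k) ⊗ parametric
representation, for every graph),
CompletionFiveR (the smallest completion identity, parametric and UNPADDED), and support items for
inversion (completion),
Cremona (duality), the 2-sum product and the calibration H(K₄) = 84. Graphs enter as edge lists E :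
Fin (2k+2) → Fin (k+2)²;
Ψ_G(x) := det [[diag x, B], [−Bᵀ, 0]] with B the reduced incidence matrix (= Σ_T Π_(e∉T) x_e,
matrix-tree; checked numerically on
K₄, K₄⊕₂K₄, K₃,₃+e); degenerate edge lists give integrand 0 and are harmless.
Lean (schematic; the literal one-line terms are the items Target = PhiFourSector, HeppForward,
TropicalLifting of this file, elaborated in the planner's Sketch.lean, rc 0): `HeppForward ∧
TropicalLifting`, with `Assembly := HeppForward → TropicalLifting → PhiFourSector` (two-line
composition, checked).

## Assembly
Pure logic: HeppForward turns equal values into equal Hepp bounds, TropicalLifting turns equal Hepp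
bounds into a move chain; the
composition is PhiFourSector (term-mode proof checked in Sketch.lean). The Assembly ends in the
local Target, NOT in
Summit.KontsevichZagierPeriods: this is a sector route and says so.

Rationale: WHY THIS LINE. Imported area: perturbative QFT's φ⁴ period corpus (Schnetz2010 census;
PanzerSchnetz2017: > 1000 exact periods) and its TROPICAL
shadow (Panzer2022: the Hepp bound = volume of the polar of the matroid polytope, a rational
invariant respecting all five period
symmetries, Thm 1.1, conjecturally PERFECT on φ⁴, Conj. 1.2; PanzerYeats2025: the Martin sequence,
conjecturally perfect, Conj. 1.10,
equal classes = equal Hepp classes for all ℓ ≤ 11, Table 3). In this sector Kontsevich–Zagier's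
Problem 1 (decide equality) is
conjecturally solved by a computable rational number, and Conjecture 1 predicts that every Hepp
coincidence hides a move chain —
including the two 8-loop pairs P₈,₃₀/P₈,₃₆ (H = 1724488/3) and P₈,₃₁/P₈,₃₅ (H = 536760) that no
known symmetry explains (Panzer2022
§5.2; still open in PanzerYeats2025 p. 10). Mechanism: Schnetz's six representations (Schnetz2010
Def.-Thm. 7) and five symmetries
are realised as explicit KZ-derivations — Feynman parameters with RATIONAL Newton–Leibniz primitives
(Beta integrals with integer
arguments), Householder reflections and fibrewise Cholesky maps as semialgebraic changes of
variables, radial integrals reduced by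
rational IBP to the representation ∫dt/(1+t²) of π (never an arctan primitive), conformal inversion
x ↦ x/|x|² for completion — and
the planner's structural observation that position space only certifies π^(2k)-PADDED identities
(π-cancellation is not a move),
so the UNPADDED parametric completion identity CompletionFiveR is open as a derivation and is
exactly what tropical lifting (sector
fans ↦ toric changes of Schwinger variables + additivity) predicts to exist. Nothing in the six
existing routes (Ayoub, ExpConservative,
Grothendieck, LowDimension, Neg, NoriTransfer) touches graph periods; the negatives index is empty.

RANKED CRUXES. #0 PhiFourSector (target) — Conjecture 1 on the φ⁴ sector: for edge lists E₁, E₂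
(2kᵢ+2 edges on kᵢ+2 vertices, all degrees ≤ 4) and representations r₁, r₂ on the open orthants of
ℝ^(2kᵢ+1) with integrands 1/Ψ_Eᵢ(x,1)², equal value ⟹ KZ.Equivalent r₁ r₂. A special case of the
summit (SectorOfSummit), not conversely. (why it might fail: False iff some two graph-period
representations with equal value are not connected by the fixed calculus, e.g. if CompletionFiveR
fails while 36 zeta(3)^2 = 36 zeta(3)^2, or an 8-loop Hepp pair has equal periods but no chain; then
the H21-literal summit is false too.) [KontsevichZagier2001, Schnetz2010, Panzer2022,
BlochEsnaultKreimer2006]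
#2 PositionIsParametric (crux) — ENGINE of the dictionary (card P2, the refuter's "real crux"): for
every edge list E on Fin (k+2) (k ≥ 1 free vertices; vertex 0 ↦ origin, vertex 1 ↦ e₁, vertex j+2 ↦
y_j ∈ ℝ⁴), the affine position-space representation on ℝ^(4k) with integrand Π_e 1/|pt(E e).1 − pt(E
e).2|² (Schnetz2010 (6d), value π^(2k)·P) is KZ-equivalent to the product representation on ℝ^(2k) ×
(open orthant of ℝ^(2k+1)) with integrand Π_i 1/(1+t_i²) · 1/Ψ_E(x,1)² (value π^(2k)·P). Route:
Feynman parameters (rational NL primitives) → complete squares (rational CoV) → fibrewise Cholesky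
scaling (semialgebraic CoV, Jacobian det^(−2) = Ψ̄/… by matrix-tree, an identity of rational
functions) → radial reductions (compactify the fibre, IBP with rational/algebraic primitives)
leaving 2k copies of ∫dt/(1+t²) → Cremona to pass from Ψ̄ to Ψ. [deps: none] [difficulty: XL]
[difficulty: XL] (why it might fail: pi^(2k) must be PRODUCED by semialgebraic moves: radial
reductions over unbounded fibres need compactifying CoV + IBP with rational/algebraic primitives;
the fibrewise Cholesky map must be ONE semialgebraic CoV; a step truly needing an arctan/log
primitive re-opens the primitive barrier.) [Schnetz2010, BlochEsnaultKreimer2006,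
KontsevichZagier2001, Brown2009FeynmanPeriods]
#3 CompletionFiveR (crux) — The smallest completion identity as an UNPADDED parametric
KZ-equivalence: the two decompletions of Γ = K₃,₄ + (ab, cd) (= P₃,₁ glued with P₃,₁ on a triangle,
Schnetz2010 Thm 10; Panzer2022 Fig. completion / Ex. 4.11) are K₃,₃ + e (edges
(0,3),(0,4),(0,5),(1,3),(1,4),(1,5),(2,3),(2,4),(2,5),(4,5)) and K₄ ⊕₂ K₄ (edges
(0,2),(0,3),(1,2),(1,3),(2,3),(0,4),(0,5),(1,4),(1,5),(4,5)); both periods equal 36 ζ(3)² ≈ 52.018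
and both Hepp bounds equal 3528 (checked with the inlined formula); the 9-dimensional
representations ∫_(x>0) dx/Ψ(x,1)² are KZ-equivalent. Via PositionIsParametric +
CompletionIsInversion only the π⁸-padded versions are connected; an unpadded chain (e.g. a
toric/Cremona-type birational map between the two graph hypersurface complements, or a
sector-by-sector correspondence as TropicalLifting predicts) would be the first parametric proof of
a completion identity. [deps: none] [difficulty: L] [difficulty: L] (why it might fail: All known
proofs of completion run in position space and certify only the pi^8-PADDED identity;
pi-cancellation is not a move and no parametric proof of completion exists (Panzer2022 sec.4), so an
unpadded chain may fail to exist although both values are 36 zeta(3)^2.) [Schnetz2010, Panzer2022,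
Brown2009FeynmanPeriods, BroadhurstKreimer1995]
#5 TropicalLifting (crux) — THE BET (card mechanism): for φ⁴ edge lists E₁, E₂ (degrees ≤ 4) with
parametric representations r₁, r₂ as in the Target, equality of the inlined Hepp bounds H(E₁) =
H(E₂) (Panzer2022 Prop. 3.2: sum over flags γ₁ ⊊ ⋯ ⊊ γ_ℓ = E of bridgeless edge sets with loops(γ_k)
= k of |γ₁|·|γ₂∖γ₁|⋯|E∖γ_(ℓ−1)| / Π_(k<ℓ)(|γ_k| − 2k)) implies KZ.Equivalent r₁ r₂. Informal
mechanism: an equality of Hepp bounds (better: of Martin sequences, PanzerYeats2025) should come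
from a weight-preserving correspondence of bridgeless-flag sectors (a rational-PL scissors
congruence of the sector fans), which lifts cone by cone to monomial changes of Schwinger variables
plus domain/integrand additivity; the five known symmetries are the calibration (their Hepp proofs
are the combinatorial shadows of the period proofs, Panzer2022 §4). [deps: none] [difficulty:
open-problem] [difficulty: open-problem] (why it might fail: One rational number is far weaker than
a sector correspondence: a pair with equal Hepp bound but different periods (none among >1000 known
periods, loops <= 11) kills it by certified numerics; or the periods agree but the fixed calculus
has no chain (summit false on the sector).) [Panzer2022, PanzerYeats2025, PanzerSchnetz2017,
Schnetz2010]
#6 HeppForward (crux) — Panzer's Conj. 1.2, forward direction, for the inlined data: φ⁴ edge lists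
with parametric representations of equal value have equal Hepp bounds. Load-bearing hypothesis of
the Assembly; hypothesis-type (nobody is expected to prove it outright: it implies
ζ-non-equalities), but refutable by one pair. [deps: none] [difficulty: open-problem] [difficulty:
open-problem] (why it might fail: Hypothesis-type, under the strength barrier: it asserts
non-equalities such as 6 zeta(3) != 20 zeta(5) (H(K4)=84 != H(W4)=572), unprovable today; false if
an exotic period coincidence links two Hepp-different phi^4 graphs.) [Panzer2022, PanzerYeats2025,
PanzerSchnetz2017]
#9 CompletionIsInversion (support) — Completion = conformal inversion (Schnetz2010 Def.-Thm. 7, step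
six) as ONE change of variables: for an edge list of a graph on Fin 3 ⊕ Fin k with degree 4 at every
free vertex inr j and no loops, the position representations with roles (origin, e₁, ∞) = (inl 0,
inl 1, inl 2) and (inl 2, inl 1, inl 0) (edges at ∞ contribute 1) are KZ-equivalent: y_j ↦
y_j/|y_j|² on the full-measure set Π(ℝ⁴∖0), Jacobian Π|y_j|^(−8), degree-4 bookkeeping swaps the
roles of inl 0 and inl 2. With PositionIsParametric this gives the π-PADDED completion invariance of
parametric representations. [difficulty: M] [difficulty: M] [Schnetz2010, BroadhurstKreimer1995]
#9 ProductK4K4 (support) — The 2-sum product identity, parametric (Brown2009FeynmanPeriods;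
Panzer2022 Prop. 4.10 analogue): the 9-dimensional representation of K₄ ⊕₂ K₄ is KZ-equivalent to
the product representation on the orthant of ℝ¹⁰ with integrand 1/Ψ_K₄(z₀…z₄,1)² · 1/Ψ_K₄(z₅…z₉,1)²
(value (6ζ(3))²): Ψ = Ψ_(A∖e)Ψ_(B/f) + Ψ_(A/e)Ψ_(B∖f), scaling CoV and one Beta integral with
integer arguments (polynomial primitive). [difficulty: M] [difficulty: M] [Brown2009FeynmanPeriods,
Panzer2022, Schnetz2010]
#9 CremonaIsAMove (support) — Duality in the dictionary: for ANY integrand shape p, ∫_(x>0)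
1/p(x,1)² ~ ∫_(u>0) 1/((Π u)·p(1/u,1))² by the single change of variables u = 1/x (for p = Ψ_G the
right side is 1/Ψ̄_G², the dual/planar-dual polynomial; Schnetz2010 step three, Panzer2022 §4.1,
BlochEsnaultKreimer2006). [difficulty: provable-now] [difficulty: provable-now]
[BlochEsnaultKreimer2006, Schnetz2010, Panzer2022]
#9 HeppK4 (support) — Calibration of the INLINED Hepp bound (it certifies the inline formula is
Panzer's): for K₄ (edges (0,1),(0,2),(0,3),(1,2),(1,3),(2,3)) the flag sum equals 84 = 12·6 + 6·2
(Panzer2022 Ex. 3.3; reproduced by script this session, together with H(W₄) = 572 and H(K₄⊕₂K₄) =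
H(K₃,₃+e) = 3528). [difficulty: M] [difficulty: M] [Panzer2022]
#9 SectorOfSummit (support) — The Target is a special case of the summit: KontsevichZagierPeriods →
PhiFourSector (the determinantal integrand is a quotient of ℚ-polynomials, positive on the orthant
or identically 0, so IsRational holds). Records the logical position of the sector. [difficulty: S]
[difficulty: S] [KontsevichZagier2001]

TWO-LAYER PLAN. Foreseen once PositionIsParametric moves: PositionIsParametric ⇐ FeynmanParametersNL
(Π 1/Q_e ~ (n−1)!∫_Δ 1/(Σ x_e Q_e)^n by rational
Newton–Leibniz) → GaussianToDeterminant (complete squares + fibrewise Cholesky CoV; det = Ψ̄ by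
matrix-tree) → RadialToPi (∫_ℝ^(4k)
(|u|²+c)^(−n) ~ rational·c^(2k−n) ⊗ (∫dt/(1+t²))^(2k)), k = 3. CompletionFiveR ⇐ (padded chain via
PositionIsParametric +
CompletionIsInversion) → (an unpadded parametric chain found by sector search), k = 2.
TropicalLifting keyed to Martin sequences
(MartinLifting) if HeppForward/TropicalLifting are refuted by a Hepp-equal pair with different
Martin sequences.

KILL CRITERIA. CompletionFiveR refuted (an additive invariant of FormalRep vanishing on the four
move sets and separating the two 5R
representations) ⇒ close refuted:CompletionFiveR AND escalate: with the classical equality of values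
it refutes the H21-literal
summit (feed route Neg). TropicalLifting or HeppForward refuted by an explicit pair ⇒ one restate
keyed to Martin sequences
(PanzerYeats2025 Conj. 1.10), not a close; refuted again ⇒ close. PositionIsParametric refuted (some
step provably needs a
non-semialgebraic primitive) ⇒ pivot the laboratory to the parametric-only dictionary (duality,
product, Fourier split) and record
that position-space QFT proofs lie outside the calculus (major input to Neg). PhiFourSector proved
elsewhere (e.g. by a sector
normal-form theorem from linear-reducibility-normal-form for linearly reducible graphs) moots only
the linearly reducible part.

NOT DECOMPOSED YET. The informal crux HeppPair831 (parRep(P₈,₃₁∖v) ~ parRep(P₈,₃₅∖v); H = 536760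
both; P(P₈,₃₁) ≈ 460.09 known, partner unknown) and its
twin P₈,₃₀/P₈,₃₆ are filed informal after open: the edge lists live in ancillary files
(PanzerSchnetz2017 periods file,
PanzerYeats2025 Martin4.txt) requested via lit want; set-signature in tenure. Not filed now: the
twist (P₇,₄ ~ P₇,₇ is also a
duality, hence one Cremona move — a weak test) and the Fourier split (Panzer's parametric proof
compiles like ProductK4K4);
W₃ = 6ζ(3) as a KZ-derivation (belongs to card linear-reducibility-normal-form; would be shared
support); π-cancellation as a
statement (π^(2k) ⊗ r ~ π^(2k) ⊗ r' ⟹ r ~ r' — a consequence of the summit, not a move); Literature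
vocabulary (graphPeriodRep,
heppBound, Martin sequence) requested as definitions — every inlined item is restated verbatim over
it once it lands; the
refined Hepp function H(G,a) and 'sliding polar' scissors congruence (the card's uniform-in-a
formulation) — note H(M,a) determines
the matroid (Panzer2022 Rem. inverse-Mellin), so only the unit-index value or the conformal subspace
can be shared between
non-isomorphic graphs; the lifting statement is therefore kept at unit indices.

CHEAPEST FALSIFIER. (i) Look-up, done: Panzer2022 §5.2 and PanzerYeats2025 §7.1 report NO pair with
equal Hepp bound and different known period among all
φ⁴ graphs with ℓ ≤ 11 (> 1000 periods) — TropicalLifting/HeppForward survive the existing data. (ii)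
Compute P(P₈,₃₅∖v) to 5 digits
by tropical Monte Carlo (kit job; Borinsky-type sector sampling) and compare with P(P₈,₃₁∖v) =
460.0885…: a certified inequality
kills Conj. 1.2 and TropicalLifting at once. (iii) For CompletionFiveR: numerically confirm both
9-dimensional integrals ≈ 52.018
(sanity of the edge lists; this session checked det = spanning-tree polynomial on both and H = 3528
on both). (iv) For
PositionIsParametric: write the k = 1 chain (bubble-type graphs, ℝ⁴, value π²) by hand — if even
that needs a transcendental
primitive the engine is dead.

NUMBERS. P(K₄) = 6ζ(3) ≈ 7.2123, H(K₄) = 84, Ĥ(K₄) = 42 (Panzer2022 Ex. 3.3, 4.11); H(W₄) = 572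
(Prop. 3.19); P(5R) = 36ζ(3)² ≈ 52.018,
H(5R) = 3528 (Ex. 4.11); H(P₈,₃₀∖v) = H(P₈,₃₆∖v) = 1724488/3, H(P₈,₃₁∖v) = H(P₈,₃₅∖v) = 536760,
P(P₈,₃₁∖v) ≈ 460.09 (Panzer2022
eq. (hepp-8loop-pairs), §5.2); counts at ℓ = 8: 41 graphs / 29 Hepp classes, ℓ = 11: 8687 / 6030
(PanzerYeats2025 Table 3); Martin
sequences of the two pairs agree for r ≤ 8 (ibid. §7.1).

DEFINITION REQUESTS. graphPeriodRep / kirchhoffPolynomial / positionRep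
(Literature/MathematicalPhysics/QuantumFieldTheory: Schnetz2010 Def.-Thm. 7,
BlochEsnaultKreimer2006; convergence ⟺ primitive as a named fact); heppBound + HeppFaithful
(Panzer2022 Def. 2.4, Prop. 3.2, Thm 1.1,
Conj. 1.2) and martinSequence + MartinFaithful (PanzerYeats2025 Def. 1.1, Conj. 1.10)
(Literature/Combinatorics/Matroid). Data want:
edge lists of P₈,₃₀, P₈,₃₁, P₈,₃₅, P₈,₃₆.

Novelty: Searches (2026-08-15): `lit search --hybrid` "Feynman period Kirchhoff polynomial completion
invariance position space" (8 QFT books,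
book:marcolli2009-feynman-motives only relevant), "Hepp bound tropical Feynman period matroid
polytope polar volume" (6, none on
rules); zbMATH "Kontsevich-Zagier periods Feynman graph" (0), "graph hypersurface Cremona
transformation period identity" (0),
"Panzer Feynman period" (2: doi:10.4171/aihpd/126, doi:10.5070/c65165021); Crossref "conjecture of
Kontsevich and Zagier … Feynman
integrals accessible identities" (8: Viu-Sos thesis, HuberMullerStach2017 ch., Ayoub2015 — none on
graph periods); S2 "Feynman periods
Martin invariant" (1: PanzerYeats2025); `lit frontier KontsevichZagierPeriods --since 2020` (30
descendants: MZV/odd-zeta/GPC items, no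
graph-period item); `lit bridges --cross any` (no QFT bridge); `lit galaxy search "completion
invariance Feynman period parametric"
--star all` (0 hits), "Hepp bound" (galaxy saturated, retried); OpenAlex/arXiv APIs rate-limited
(429) — logged. Read: Panzer2022
(arXiv:1908.09820) §§1–5, PanzerYeats2025 (arXiv:2304.05299) §§1, 7, Schnetz2010 (arXiv:0801.2856)
§2; plus the card's own audit
(refuter-7: QFT side fully in print; rule-chains and lifting NOT in print).
Nearest prior art found: Panzer2022 = doi:10.4171/aihpd/126 (Hepp bound, its five symmetries, Conj.
1.2, the unexplained 8-loop pairs);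
PanzerYeats2025 = doi:10.5070/c65165021 (Martin sequence, conjectured perfect; pairs still
unexplained, p  [refs: 10.4171/aihpd/126, 10.5070/c65165021, 10.4310/cntp.2010.v4.n1.a1, 1908.09820, 2304.05299, 0801.2856, book:marcolli2009-feynman-motives, doi:10.4171/aihpd/126, doi:10.5070/c65165021, doi:10.4310/cntp.2010.v4.n1.a1, book:marcolli2009-feynman-motives., HuberMullerStach2017, Ayoub2015, PanzerYeats2025, Panzer2022, Schnetz2010, BlochEsnaultKreimer2006]

Barriers (technique_class: tropical-lifting, feynman-parametric-compilation, sector): - technique_class: tropical-lifting, feynman-parametric-compilation, sector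
- Literature.Barriers.KontsevichZagierPeriods.noSemialgebraicPrimitive_inv_sub_two: ENGAGED by
PositionIsParametric and ProductK4K4 and evaded by design — every Newton–Leibniz step uses a
RATIONAL primitive (Beta integrals with integer arguments, IBP reductions u/(1+u²)^(s−1)) or an
ALGEBRAIC one ((1+u²)^(1/2−s) family), π is kept as the representation ∫dt/(1+t²) and never
integrated, logarithms never arise (no hyperlogarithm integration is performed; W₃ = 6ζ(3) is
deliberately NOT an item); the crux's why-might-fail names exactly the place the barrier could
re-enter.
- Literature.Barriers.KontsevichZagierPeriods.cressonViuSos_prop_3_2: not engaged — no global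
volume-preserving map between two representations is sought; tropical lifting is cone-by-cone
(scissors: domain additivity + one monomial map per sector), CremonaIsAMove/CompletionIsInversion
are single changes of variables on full-measure open cells with the null complement handled by
additivity, which the Hauptvermutung obstruction does not concern.
- Literature.Barriers.KontsevichZagierPeriods.not_complete_of_undecidable: consistent and on the
constructive side — on the φ⁴ sector equality is conjecturally decided by a computable rational
(Hepp) or integer-sequence (Martin) invariant, the strongest form of decidability; no undecidability
input exists for graph periods.
- Literature.Barriers.KontsevichZagierPeriods.kzConjecture_implies_oddZetaA

History (route lifecycle, newest last):
- 2026-08-15T13:48:36Z · CLOSED retired — not-a-thesis: assembly does not conclude the sub-problem Statement (operator:999:1257524)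

sub-problem: KontsevichZagierPeriods · status: closed(retired) · opened planner-plancard-KontsevichZagierPeriods-Kont-37c8eac3-0 2026-08-15T11:20:04Z · rev 0 · ledger route-KontsevichZagierPeriods-PhiFourLaboratory
GENERATED by the gate from the ledger (D-0016/17). Provers cite these decls: `theorem foo : Summit.KontsevichZagierPeriods.KontsevichZagierPeriods.Theses.PhiFourLaboratory.<Decl> := …` in Summits/KontsevichZagierPeriods/KontsevichZagierPeriods/Theorems/<Name>.lean.
-/

namespace Summit.KontsevichZagierPeriods.KontsevichZagierPeriods.Theses.PhiFourLaboratory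

open scoped BigOperators Topology Manifold Classical MeasureTheory ProbabilityTheory Matrix InnerProductSpace ComplexConjugate ContinuousMap
open Filter Set Function TopologicalSpace MeasureTheory

attribute [summit_statement] _root_.KontsevichZagierPeriods

open Literature Periods

/-- item stmt-KontsevichZagierPeriods-3560 · target · rank 0 · closed · moot by None · by planner
why it might fail: False iff some two graph-period representations with equal value are not connected by the fixed calculus, e.g. if CompletionFiveR fails while 36 zeta(3)^2 = 36 zeta(3)^2, or an 8-loop Hepp pair has equal periods but no chain; then the H21-literal summit is false too.
sources: KontsevichZagier2001, Schnetz2010, Panzer2022, BlochEsnaultKreimer2006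
[target] Conjecture 1 on the φ⁴ sector: for edge lists E₁, E₂ (2kᵢ+2 edges on kᵢ+2 vertices, all
degrees ≤ 4) and representations r₁, r₂ on the open orthants of ℝ^(2kᵢ+1) with integrands
1/Ψ_Eᵢ(x,1)², equal value ⟹ KZ.Equivalent r₁ r₂. A special case of the summit (SectorOfSummit), not
conversely. -/
@[route_item "route-KontsevichZagierPeriods-PhiFourLaboratory"]
def PhiFourSector : Prop :=
  ∀ (k₁ k₂ : ℕ) (E₁ : Fin (2*k₁+2) → Fin (k₁+2) × Fin (k₁+2)) (E₂ : Fin (2*k₂+2) → Fin (k₂+2) × Fin (k₂+2)), (∀ v, (Finset.univ.filter fun e => (E₁ e).1 = v ∨ (E₁ e).2 = v).card ≤ 4) → (∀ v, (Finset.univ.filter fun e => (E₂ e).1 = v ∨ (E₂ e).2 = v).card ≤ 4) → ∀ (r₁ : Literature.NumberTheory.Transcendental.KZ.IntegralRep (2*k₁+1)) (r₂ : Literature.NumberTheory.Transcendental.KZ.IntegralRep (2*k₂+1)), r₁.domain = {x | ∀ j, 0 < x j} → Set.EqOn r₁.integrand (fun x => 1 / ((Matrix.fromBlocks (Matrix.diagonal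 (Fin.snoc x (1:ℝ) : Fin (2*k₁+2) → ℝ)) (Matrix.of fun (e : Fin (2*k₁+2)) (j : Fin (k₁+1)) => ((if (E₁ e).1 = j.succ then (1:ℝ) else 0) - (if (E₁ e).2 = j.succ then (1:ℝ) else 0))) (-(Matrix.of fun (e : Fin (2*k₁+2)) (j : Fin (k₁+1)) => ((if (E₁ e).1 = j.succ then (1:ℝ) else 0) - (if (E₁ e).2 = j.succ then (1:ℝ) else 0))).transpose) (0 : Matrix (Fin (k₁+1)) (Fin (k₁+1)) ℝ)).det) ^ 2) r₁.domain → r₂.domain = {x | ∀ j, 0 < x j} → Set.EqOn r₂.integrand (fun x => 1 / ((Matrix.fromBlocks (Matrix.diagonal (Fin.snoc x (1:ℝ) : Fin (2*k₂+2) → ℝ)) (Matrix.of fun (e : Fin (2*k₂+2)) (j : Fin (k₂+1)) => ((if (E₂ e).1 = j.succ then (1:ℝ) else 0) - (if (E₂ e).2 = j.succ then (1:ℝ) else 0))) (-(Matrix.of fun (e : Fin (2*k₂+2)) (j : Fin (k₂+1)) => ((if (E₂ e).1 = j.succ then (1:ℝ) else 0) - (if (E₂ e).2 = j.succ then (1:ℝ)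 else 0))).transpose) (0 : Matrix (Fin (k₂+1)) (Fin (k₂+1)) ℝ)).det) ^ 2) r₂.domain → r₁.value = r₂.value → Literature.NumberTheory.Transcendental.KZ.Equivalent r₁ r₂

/-- item stmt-KontsevichZagierPeriods-3561 · crux · rank 2 · closed · moot by None · by planner
why it might fail: pi^(2k) must be PRODUCED by semialgebraic moves: radial reductions over unbounded fibres need compactifying CoV + IBP with rational/algebraic primitives; the fibrewise Cholesky map must be ONE semialgebraic CoV; a step truly needing an arctan/log primitive re-opens the primitive barrier.
sources: Schnetz2010, BlochEsnaultKreimer2006, KontsevichZagier2001, Brown2009FeynmanPeriods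
[crux] ENGINE of the dictionary (card P2, the refuter's "real crux"): for every edge list E on Fin
(k+2) (k ≥ 1 free vertices; vertex 0 ↦ origin, vertex 1 ↦ e₁, vertex j+2 ↦ y_j ∈ ℝ⁴), the affine
position-space representation on ℝ^(4k) with integrand Π_e 1/|pt(E e).1 − pt(E e).2|² (Schnetz2010
(6d), value π^(2k)·P) is KZ-equivalent to the product representation on ℝ^(2k) × (open orthant of
ℝ^(2k+1)) with integrand Π_i 1/(1+t_i²) · 1/Ψ_E(x,1)² (value π^(2k)·P). Route: Feynman parameters
(rational NL primitives) → complete squares (rational CoV) → fibrewise Cholesky scaling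
(semialgebraic CoV, Jacobian det^(−2) = Ψ̄/… by matrix-tree, an identity of rational functions) →
radial reductions (compactify the fibre, IBP with rational/algebraic primitives) leaving 2k copies
of ∫dt/(1+t²) → Cremona to pass from Ψ̄ to Ψ. [deps: none] [difficulty: XL] [difficulty: XL] -/
@[route_item "route-KontsevichZagierPeriods-PhiFourLaboratory"]
def PositionIsParametric : Prop :=
  ∀ (k : ℕ), 1 ≤ k → ∀ (E : Fin (2*k+2) → Fin (k+2) × Fin (k+2)) (r : Literature.NumberTheory.Transcendental.KZ.IntegralRep (k*4)) (r' : Literature.NumberTheory.Transcendental.KZ.IntegralRep (2*k + (2*k+1))), r.domain = Set.univ → (∀ y, r.integrand y = ∏ e : Fin (2*k+2), 1 / (∑ i : Fin 4, ((Fin.cons (0 : Fin 4 → ℝ) (Fin.cons (fun i : Fin 4 => if i = 0 then (1:ℝ) else 0) (fun (j : Fin k) (i : Fin 4) => y (finProdFinEquiv (j, i)))) : Fin (k+2) → Fin 4 → ℝ) (E e).1 i - (Fin.cons (0 : Fin 4 → ℝ) (Fin.cons (fun i : Fin 4 => if i = 0 then (1:ℝ) else 0) (fun (j : Fin k) (i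 : Fin 4) => y (finProdFinEquiv (j, i)))) : Fin (k+2) → Fin 4 → ℝ) (E e).2 i) ^ 2)) → r'.domain = {z | ∀ j : Fin (2*k+1), 0 < z (Fin.natAdd (2*k) j)} → Set.EqOn r'.integrand (fun z => (∏ i : Fin (2*k), 1 / (1 + (z (Fin.castAdd (2*k+1) i)) ^ 2)) * (1 / ((Matrix.fromBlocks (Matrix.diagonal (Fin.snoc (fun j : Fin (2*k+1) => z (Fin.natAdd (2*k) j)) (1:ℝ) : Fin (2*k+2) → ℝ)) (Matrix.of fun (e : Fin (2*k+2)) (j : Fin (k+1)) => ((if (E e).1 = j.succ then (1:ℝ) else 0) - (if (E e).2 = j.succ then (1:ℝ) else 0))) (-(Matrix.of fun (e : Fin (2*k+2)) (j : Fin (k+1)) => ((if (E e).1 = j.succ then (1:ℝ) else 0) - (if (E e).2 = j.succ then (1:ℝ) else 0))).transpose) (0 : Matrix (Fin (k+1)) (Fin (k+1)) ℝ)).det) ^ 2)) r'.domain → Literature.NumberTheory.Transcendental.KZ.Equivalent r r'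

/-- item stmt-KontsevichZagierPeriods-3562 · crux · rank 3 · closed · moot by None · by planner
why it might fail: All known proofs of completion run in position space and certify only the pi^8-PADDED identity; pi-cancellation is not a move and no parametric proof of completion exists (Panzer2022 sec.4), so an unpadded chain may fail to exist although both values are 36 zeta(3)^2.
sources: Schnetz2010, Panzer2022, Brown2009FeynmanPeriods, BroadhurstKreimer1995
[crux] The smallest completion identity as an UNPADDED parametric KZ-equivalence: the two
decompletions of Γ = K₃,₄ + (ab, cd) (= P₃,₁ glued with P₃,₁ on a triangle, Schnetz2010 Thm 10;
Panzer2022 Fig. completion / Ex. 4.11) are K₃,₃ + e (edges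
(0,3),(0,4),(0,5),(1,3),(1,4),(1,5),(2,3),(2,4),(2,5),(4,5)) and K₄ ⊕₂ K₄ (edges
(0,2),(0,3),(1,2),(1,3),(2,3),(0,4),(0,5),(1,4),(1,5),(4,5)); both periods equal 36 ζ(3)² ≈ 52.018
and both Hepp bounds equal 3528 (checked with the inlined formula); the 9-dimensional
representations ∫_(x>0) dx/Ψ(x,1)² are KZ-equivalent. Via PositionIsParametric +
CompletionIsInversion only the π⁸-padded versions are connected; an unpadded chain (e.g. a
toric/Cremona-type birational map between the two graph hypersurface complements, or a
sector-by-sector correspondence as TropicalLifting predicts) would be the first parametric proof of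
a completion identity. [deps: none] [difficulty: L] [difficulty: L] -/
@[route_item "route-KontsevichZagierPeriods-PhiFourLaboratory"]
def CompletionFiveR : Prop :=
  ∀ (r r' : Literature.NumberTheory.Transcendental.KZ.IntegralRep 9), r.domain = {x | ∀ j, 0 < x j} → Set.EqOn r.integrand (fun x => 1 / ((Matrix.fromBlocks (Matrix.diagonal (Fin.snoc x (1:ℝ) : Fin 10 → ℝ)) (Matrix.of fun (e : Fin 10) (j : Fin 5) => ((if ((![(0, 3), (0, 4), (0, 5), (1, 3), (1, 4), (1, 5), (2, 3), (2, 4), (2, 5), (4, 5)] : Fin 10 → Fin 6 × Fin 6) e).1 = j.succ then (1:ℝ) else 0) - (if ((![(0, 3), (0, 4), (0, 5), (1, 3), (1, 4), (1, 5), (2, 3), (2, 4), (2, 5), (4, 5)] : Fin 10 → Fin 6 × Fin 6) e).2 = j.succ then (1:ℝ) else 0))) (-(Matrix.of fun (e : Fin 10) (j : Fin 5) => ((if ((![(0, 3), (0, 4), (0, 5), (1, 3), (1, 4), (1, 5), (2, 3), (2, 4), (2, 5), (4, 5)] : Fin 10 → Fin 6 × Fin 6) e).1 = j.succ then (1:ℝ)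 else 0) - (if ((![(0, 3), (0, 4), (0, 5), (1, 3), (1, 4), (1, 5), (2, 3), (2, 4), (2, 5), (4, 5)] : Fin 10 → Fin 6 × Fin 6) e).2 = j.succ then (1:ℝ) else 0))).transpose) (0 : Matrix (Fin 5) (Fin 5) ℝ)).det) ^ 2) r.domain → r'.domain = {x | ∀ j, 0 < x j} → Set.EqOn r'.integrand (fun x => 1 / ((Matrix.fromBlocks (Matrix.diagonal (Fin.snoc x (1:ℝ) : Fin 10 → ℝ)) (Matrix.of fun (e : Fin 10) (j : Fin 5) => ((if ((![(0, 2), (0, 3), (1, 2), (1, 3), (2, 3), (0, 4), (0, 5), (1, 4), (1, 5), (4, 5)] : Fin 10 → Fin 6 × Fin 6) e).1 = j.succ then (1:ℝ) else 0) - (if ((![(0, 2), (0, 3), (1, 2), (1, 3), (2, 3), (0, 4), (0, 5), (1, 4), (1, 5), (4, 5)] : Fin 10 → Fin 6 × Fin 6) e).2 = j.succ then (1:ℝ) else 0))) (-(Matrix.of fun (e : Fin 10) (j : Fin 5) => ((if ((![(0, 2), (0, 3), (1, 2), (1, 3), (2, 3), (0, 4), (0, 5), (1, 4), (1, 5), (4,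 5)] : Fin 10 → Fin 6 × Fin 6) e).1 = j.succ then (1:ℝ) else 0) - (if ((![(0, 2), (0, 3), (1, 2), (1, 3), (2, 3), (0, 4), (0, 5), (1, 4), (1, 5), (4, 5)] : Fin 10 → Fin 6 × Fin 6) e).2 = j.succ then (1:ℝ) else 0))).transpose) (0 : Matrix (Fin 5) (Fin 5) ℝ)).det) ^ 2) r'.domain → Literature.NumberTheory.Transcendental.KZ.Equivalent r r'

/-- item stmt-KontsevichZagierPeriods-3563 · crux · rank 5 · closed · moot by None · by planner
why it might fail: One rational number is far weaker than a sector correspondence: a pair with equal Hepp bound but different periods (none among >1000 known periods, loops <= 11) kills it by certified numerics; or the periods agree but the fixed calculus has no chain (summit false on the sector).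
sources: Panzer2022, PanzerYeats2025, PanzerSchnetz2017, Schnetz2010
[crux] THE BET (card mechanism): for φ⁴ edge lists E₁, E₂ (degrees ≤ 4) with parametric
representations r₁, r₂ as in the Target, equality of the inlined Hepp bounds H(E₁) = H(E₂)
(Panzer2022 Prop. 3.2: sum over flags γ₁ ⊊ ⋯ ⊊ γ_ℓ = E of bridgeless edge sets with loops(γ_k) = k
of |γ₁|·|γ₂∖γ₁|⋯|E∖γ_(ℓ−1)| / Π_(k<ℓ)(|γ_k| − 2k)) implies KZ.Equivalent r₁ r₂. Informal mechanism:
an equality of Hepp bounds (better: of Martin sequences, PanzerYeats2025) should come from a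
weight-preserving correspondence of bridgeless-flag sectors (a rational-PL scissors congruence of
the sector fans), which lifts cone by cone to monomial changes of Schwinger variables plus
domain/integrand additivity; the five known symmetries are the calibration (their Hepp proofs are
the combinatorial shadows of the period proofs, Panzer2022 §4). [deps: none] [difficulty:
open-problem] [difficulty: open-problem] -/
@[route_item "route-KontsevichZagierPeriods-PhiFourLaboratory"]
def TropicalLifting : Prop :=
  ∀ (k₁ k₂ : ℕ) (E₁ : Fin (2*k₁+2) → Fin (k₁+2) × Fin (k₁+2)) (E₂ : Fin (2*k₂+2) → Fin (k₂+2) × Fin (k₂+2)), (∀ v, (Finset.univ.filter fun e => (E₁ e).1 = v ∨ (E₁ e).2 = v).card ≤ 4) → (∀ v, (Finset.univ.filter fun e => (E₂ e).1 = v ∨ (E₂ e).2 = v).card ≤ 4) → ∀ (r₁ : Literature.NumberTheory.Transcendental.KZ.IntegralRep (2*k₁+1)) (r₂ : Literature.NumberTheory.Transcendental.KZ.IntegralRep (2*k₂+1)), r₁.domain = {x | ∀ j, 0 < x j} → Set.EqOn r₁.integrand (fun x => 1 / ((Matrix.fromBlocks (Matrix.diagonal (Fin.snoc x (1:ℝ)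 : Fin (2*k₁+2) → ℝ)) (Matrix.of fun (e : Fin (2*k₁+2)) (j : Fin (k₁+1)) => ((if (E₁ e).1 = j.succ then (1:ℝ) else 0) - (if (E₁ e).2 = j.succ then (1:ℝ) else 0))) (-(Matrix.of fun (e : Fin (2*k₁+2)) (j : Fin (k₁+1)) => ((if (E₁ e).1 = j.succ then (1:ℝ) else 0) - (if (E₁ e).2 = j.succ then (1:ℝ) else 0))).transpose) (0 : Matrix (Fin (k₁+1)) (Fin (k₁+1)) ℝ)).det) ^ 2) r₁.domain → r₂.domain = {x | ∀ j, 0 < x j} → Set.EqOn r₂.integrand (fun x => 1 / ((Matrix.fromBlocks (Matrix.diagonal (Fin.snoc x (1:ℝ) : Fin (2*k₂+2) → ℝ)) (Matrix.of fun (e : Fin (2*k₂+2)) (j : Fin (k₂+1)) => ((if (E₂ e).1 = j.succ then (1:ℝ) else 0) - (if (E₂ e).2 = j.succ then (1:ℝ) else 0))) (-(Matrix.of fun (e : Fin (2*k₂+2)) (j : Fin (k₂+1)) => ((if (E₂ e).1 = j.succ then (1:ℝ) else 0) - (if (E₂ e).2 = j.succ then (1:ℝ) else 0))).transpose) (0 :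 Matrix (Fin (k₂+1)) (Fin (k₂+1)) ℝ)).det) ^ 2) r₂.domain → (∑ c : Fin (k₁+1) → Finset (Fin (2*k₁+2)), if ((∀ i : Fin (k₁+1), (c i).Nonempty ∧ (∀ e ∈ c i, (Matrix.of fun (p : {p // p ∈ (c i).erase e}) (v : Fin (k₁+2)) => ((if (E₁ p.1).1 = v then (1:ℚ) else 0) - (if (E₁ p.1).2 = v then (1:ℚ) else 0))).rank = (Matrix.of fun (p : {p // p ∈ c i}) (v : Fin (k₁+2)) => ((if (E₁ p.1).1 = v then (1:ℚ) else 0) - (if (E₁ p.1).2 = v then (1:ℚ) else 0))).rank) ∧ (c i).card - (Matrix.of fun (p : {p // p ∈ c i}) (v : Fin (k₁+2)) => ((if (E₁ p.1).1 = v then (1:ℚ) else 0) - (if (E₁ p.1).2 = v then (1:ℚ) else 0))).rank = i.val + 1) ∧ (∀ i j : Fin (k₁+1), i < j → c i ⊂ c j) ∧ c (Fin.last k₁) = Finset.univ) then ((c 0).card : ℚ) * (∏ i : Fin k₁, (((c i.succ).card : ℚ) - ((c i.castSucc).card : ℚ))) / (∏ i : Fin k₁, (((c i.castSucc).card : ℚ)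 - 2 * ((i.val : ℚ) + 1))) else 0) = (∑ c : Fin (k₂+1) → Finset (Fin (2*k₂+2)), if ((∀ i : Fin (k₂+1), (c i).Nonempty ∧ (∀ e ∈ c i, (Matrix.of fun (p : {p // p ∈ (c i).erase e}) (v : Fin (k₂+2)) => ((if (E₂ p.1).1 = v then (1:ℚ) else 0) - (if (E₂ p.1).2 = v then (1:ℚ) else 0))).rank = (Matrix.of fun (p : {p // p ∈ c i}) (v : Fin (k₂+2)) => ((if (E₂ p.1).1 = v then (1:ℚ) else 0) - (if (E₂ p.1).2 = v then (1:ℚ) else 0))).rank) ∧ (c i).card - (Matrix.of fun (p : {p // p ∈ c i}) (v : Fin (k₂+2)) => ((if (E₂ p.1).1 = v then (1:ℚ) else 0) - (if (E₂ p.1).2 = v then (1:ℚ) else 0))).rank = i.val + 1) ∧ (∀ i j : Fin (k₂+1), i < j → c i ⊂ c j) ∧ c (Fin.last k₂) = Finset.univ) then ((c 0).card : ℚ) * (∏ i : Fin k₂, (((c i.succ).card : ℚ) - ((c i.castSucc).card : ℚ))) / (∏ i : Fin k₂, (((c i.castSucc).card : ℚ) - 2 * ((i.val : ℚ) + 1)))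 else 0) → Literature.NumberTheory.Transcendental.KZ.Equivalent r₁ r₂

/-- item stmt-KontsevichZagierPeriods-3564 · crux · rank 6 · closed · moot by None · by planner
why it might fail: Hypothesis-type, under the strength barrier: it asserts non-equalities such as 6 zeta(3) != 20 zeta(5) (H(K4)=84 != H(W4)=572), unprovable today; false if an exotic period coincidence links two Hepp-different phi^4 graphs.
sources: Panzer2022, PanzerYeats2025, PanzerSchnetz2017
[crux] Panzer's Conj. 1.2, forward direction, for the inlined data: φ⁴ edge lists with parametric
representations of equal value have equal Hepp bounds. Load-bearing hypothesis of the Assembly;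
hypothesis-type (nobody is expected to prove it outright: it implies ζ-non-equalities), but
refutable by one pair. [deps: none] [difficulty: open-problem] [difficulty: open-problem] -/
@[route_item "route-KontsevichZagierPeriods-PhiFourLaboratory"]
def HeppForward : Prop :=
  ∀ (k₁ k₂ : ℕ) (E₁ : Fin (2*k₁+2) → Fin (k₁+2) × Fin (k₁+2)) (E₂ : Fin (2*k₂+2) → Fin (k₂+2) × Fin (k₂+2)), (∀ v, (Finset.univ.filter fun e => (E₁ e).1 = v ∨ (E₁ e).2 = v).card ≤ 4) → (∀ v, (Finset.univ.filter fun e => (E₂ e).1 = v ∨ (E₂ e).2 = v).card ≤ 4) → ∀ (r₁ : Literature.NumberTheory.Transcendental.KZ.IntegralRep (2*k₁+1)) (r₂ : Literature.NumberTheory.Transcendental.KZ.IntegralRep (2*k₂+1)), r₁.domain = {x | ∀ j, 0 < x j} → Set.EqOn r₁.integrand (fun x => 1 / ((Matrix.fromBlocks (Matrix.diagonal (Fin.snoc x (1:ℝ) : Fin (2*k₁+2) → ℝ)) (Matrix.of fun (e : Fin (2*k₁+2)) (j : Fin (k₁+1)) => ((if (E₁ e).1 = j.succ then (1:ℝ)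 else 0) - (if (E₁ e).2 = j.succ then (1:ℝ) else 0))) (-(Matrix.of fun (e : Fin (2*k₁+2)) (j : Fin (k₁+1)) => ((if (E₁ e).1 = j.succ then (1:ℝ) else 0) - (if (E₁ e).2 = j.succ then (1:ℝ) else 0))).transpose) (0 : Matrix (Fin (k₁+1)) (Fin (k₁+1)) ℝ)).det) ^ 2) r₁.domain → r₂.domain = {x | ∀ j, 0 < x j} → Set.EqOn r₂.integrand (fun x => 1 / ((Matrix.fromBlocks (Matrix.diagonal (Fin.snoc x (1:ℝ) : Fin (2*k₂+2) → ℝ)) (Matrix.of fun (e : Fin (2*k₂+2)) (j : Fin (k₂+1)) => ((if (E₂ e).1 = j.succ then (1:ℝ) else 0) - (if (E₂ e).2 = j.succ then (1:ℝ) else 0))) (-(Matrix.of fun (e : Fin (2*k₂+2)) (j : Fin (k₂+1)) => ((if (E₂ e).1 = j.succ then (1:ℝ) else 0) - (if (E₂ e).2 = j.succ then (1:ℝ) else 0))).transpose) (0 : Matrix (Fin (k₂+1)) (Fin (k₂+1)) ℝ)).det) ^ 2) r₂.domain → r₁.value = r₂.value → (∑ c : Fin (k₁+1) → Finset (Fin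 (2*k₁+2)), if ((∀ i : Fin (k₁+1), (c i).Nonempty ∧ (∀ e ∈ c i, (Matrix.of fun (p : {p // p ∈ (c i).erase e}) (v : Fin (k₁+2)) => ((if (E₁ p.1).1 = v then (1:ℚ) else 0) - (if (E₁ p.1).2 = v then (1:ℚ) else 0))).rank = (Matrix.of fun (p : {p // p ∈ c i}) (v : Fin (k₁+2)) => ((if (E₁ p.1).1 = v then (1:ℚ) else 0) - (if (E₁ p.1).2 = v then (1:ℚ) else 0))).rank) ∧ (c i).card - (Matrix.of fun (p : {p // p ∈ c i}) (v : Fin (k₁+2)) => ((if (E₁ p.1).1 = v then (1:ℚ) else 0) - (if (E₁ p.1).2 = v then (1:ℚ) else 0))).rank = i.val + 1) ∧ (∀ i j : Fin (k₁+1), i < j → c i ⊂ c j) ∧ c (Fin.last k₁) = Finset.univ) then ((c 0).card : ℚ) * (∏ i : Fin k₁, (((c i.succ).card : ℚ) - ((c i.castSucc).card : ℚ))) / (∏ i : Fin k₁, (((c i.castSucc).card : ℚ) - 2 * ((i.val : ℚ) + 1))) else 0) = (∑ c : Fin (k₂+1) → Finset (Fin (2*k₂+2)), if ((∀ i : Fin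 (k₂+1), (c i).Nonempty ∧ (∀ e ∈ c i, (Matrix.of fun (p : {p // p ∈ (c i).erase e}) (v : Fin (k₂+2)) => ((if (E₂ p.1).1 = v then (1:ℚ) else 0) - (if (E₂ p.1).2 = v then (1:ℚ) else 0))).rank = (Matrix.of fun (p : {p // p ∈ c i}) (v : Fin (k₂+2)) => ((if (E₂ p.1).1 = v then (1:ℚ) else 0) - (if (E₂ p.1).2 = v then (1:ℚ) else 0))).rank) ∧ (c i).card - (Matrix.of fun (p : {p // p ∈ c i}) (v : Fin (k₂+2)) => ((if (E₂ p.1).1 = v then (1:ℚ) else 0) - (if (E₂ p.1).2 = v then (1:ℚ) else 0))).rank = i.val + 1) ∧ (∀ i j : Fin (k₂+1), i < j → c i ⊂ c j) ∧ c (Fin.last k₂) = Finset.univ) then ((c 0).card : ℚ) * (∏ i : Fin k₂, (((c i.succ).card : ℚ) - ((c i.castSucc).card : ℚ))) / (∏ i : Fin k₂, (((c i.castSucc).card : ℚ) - 2 * ((i.val : ℚ) + 1))) else 0)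

-- item stmt-KontsevichZagierPeriods-3643 · support · rank 4 · closed · moot by None · by planner — informal only, no Lean statement yet:
--   [crux] OPEN INSTANCE with a predicted answer (Panzer2022 §1, §5.2; PanzerYeats2025 §7.1, p. 10): the
--   parametric representations of the decompleted 8-loop graphs P₈,₃₁∖v and P₈,₃₅∖v (Schnetz2010 census
--   notation; 16 edges, dimension 15, integrands 1/Ψ(x,1)² on the open orthant, exactly the shape of the
--   Target with k = 7) are KZ.Equivalent. H(P₈,₃₁∖v) = H(P₈,₃₅∖v) = 536760, equal c₂ invariants,
--   permanents and Martin sequences M(G^[r]) for r ≤ 8; P(P₈,₃₁∖v) ≈ 460.09 is known exactly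
--   (PanzerSchnetz2017), P(P₈,₃₅∖v) is unknown; no known symmetry (product, duality, twist, completion,
--   Fourier split) c

/-- item stmt-KontsevichZagierPeriods-3565 · support · rank 9 · closed · moot by None · by planner
sources: Schnetz2010, BroadhurstKreimer1995
[support] Completion = conformal inversion (Schnetz2010 Def.-Thm. 7, step six) as ONE change of
variables: for an edge list of a graph on Fin 3 ⊕ Fin k with degree 4 at every free vertex inr j and
no loops, the position representations with roles (origin, e₁, ∞) = (inl 0, inl 1, inl 2) and (inl
2, inl 1, inl 0) (edges at ∞ contribute 1) are KZ-equivalent: y_j ↦ y_j/|y_j|² on the full-measure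
set Π(ℝ⁴∖0), Jacobian Π|y_j|^(−8), degree-4 bookkeeping swaps the roles of inl 0 and inl 2. With
PositionIsParametric this gives the π-PADDED completion invariance of parametric representations.
[difficulty: M] [difficulty: M] -/
@[route_item "route-KontsevichZagierPeriods-PhiFourLaboratory"]
def CompletionIsInversion : Prop :=
  ∀ (k : ℕ) (E : Fin (2*k+6) → (Fin 3 ⊕ Fin k) × (Fin 3 ⊕ Fin k)), (∀ j : Fin k, (Finset.univ.filter fun e => (E e).1 = Sum.inr j ∨ (E e).2 = Sum.inr j).card = 4) → (∀ e, (E e).1 ≠ (E e).2) → ∀ (r r' : Literature.NumberTheory.Transcendental.KZ.IntegralRep (k*4)), r.domain = Set.univ → (∀ y, r.integrand y = ∏ e : Fin (2*k+6), if (E e).1 = Sum.inl 2 ∨ (E e).2 = Sum.inl 2 then (1:ℝ) else 1 / (∑ i : Fin 4, ((Sum.elim ![(0 : Fin 4 → ℝ), (fun i : Fin 4 => if i = 0 then (1:ℝ) else 0), 0] (fun (j : Fin k) (i : Fin 4) => y (finProdFinEquiv (j, i)))) (E e).1 i - (Sum.elim ![(0 : Fin 4 → ℝ), (fun i : Fin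 4 => if i = 0 then (1:ℝ) else 0), 0] (fun (j : Fin k) (i : Fin 4) => y (finProdFinEquiv (j, i)))) (E e).2 i) ^ 2)) → r'.domain = Set.univ → (∀ y, r'.integrand y = ∏ e : Fin (2*k+6), if (E e).1 = Sum.inl 0 ∨ (E e).2 = Sum.inl 0 then (1:ℝ) else 1 / (∑ i : Fin 4, ((Sum.elim ![(0 : Fin 4 → ℝ), (fun i : Fin 4 => if i = 0 then (1:ℝ) else 0), 0] (fun (j : Fin k) (i : Fin 4) => y (finProdFinEquiv (j, i)))) (E e).1 i - (Sum.elim ![(0 : Fin 4 → ℝ), (fun i : Fin 4 => if i = 0 then (1:ℝ) else 0), 0] (fun (j : Fin k) (i : Fin 4) => y (finProdFinEquiv (j, i)))) (E e).2 i) ^ 2)) → Literature.NumberTheory.Transcendental.KZ.Equivalent r r'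

/-- item stmt-KontsevichZagierPeriods-3566 · support · rank 9 · closed · moot by None · by planner
sources: Brown2009FeynmanPeriods, Panzer2022, Schnetz2010
[support] The 2-sum product identity, parametric (Brown2009FeynmanPeriods; Panzer2022 Prop. 4.10
analogue): the 9-dimensional representation of K₄ ⊕₂ K₄ is KZ-equivalent to the product
representation on the orthant of ℝ¹⁰ with integrand 1/Ψ_K₄(z₀…z₄,1)² · 1/Ψ_K₄(z₅…z₉,1)² (value
(6ζ(3))²): Ψ = Ψ_(A∖e)Ψ_(B/f) + Ψ_(A/e)Ψ_(B∖f), scaling CoV and one Beta integral with integer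
arguments (polynomial primitive). [difficulty: M] [difficulty: M] -/
@[route_item "route-KontsevichZagierPeriods-PhiFourLaboratory"]
def ProductK4K4 : Prop :=
  ∀ (r : Literature.NumberTheory.Transcendental.KZ.IntegralRep 9) (r' : Literature.NumberTheory.Transcendental.KZ.IntegralRep 10), r.domain = {x | ∀ j, 0 < x j} → Set.EqOn r.integrand (fun x => 1 / ((Matrix.fromBlocks (Matrix.diagonal (Fin.snoc x (1:ℝ) : Fin 10 → ℝ)) (Matrix.of fun (e : Fin 10) (j : Fin 5) => ((if ((![(0, 2), (0, 3), (1, 2), (1, 3), (2, 3), (0, 4), (0, 5), (1, 4), (1, 5), (4, 5)] : Fin 10 → Fin 6 × Fin 6) e).1 = j.succ then (1:ℝ) else 0) - (if ((![(0, 2), (0, 3), (1, 2), (1, 3), (2, 3), (0, 4), (0, 5), (1, 4), (1, 5), (4, 5)] : Fin 10 → Fin 6 × Fin 6) e).2 = j.succ then (1:ℝ) else 0))) (-(Matrix.of fun (e : Fin 10) (j : Fin 5) => ((if ((![(0, 2), (0, 3), (1, 2), (1, 3), (2, 3), (0, 4), (0, 5), (1, 4), (1, 5), (4, 5)] : Fin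 10 → Fin 6 × Fin 6) e).1 = j.succ then (1:ℝ) else 0) - (if ((![(0, 2), (0, 3), (1, 2), (1, 3), (2, 3), (0, 4), (0, 5), (1, 4), (1, 5), (4, 5)] : Fin 10 → Fin 6 × Fin 6) e).2 = j.succ then (1:ℝ) else 0))).transpose) (0 : Matrix (Fin 5) (Fin 5) ℝ)).det) ^ 2) r.domain → r'.domain = {z | ∀ j, 0 < z j} → Set.EqOn r'.integrand (fun z => (1 / ((Matrix.fromBlocks (Matrix.diagonal (Fin.snoc (fun j : Fin 5 => z (Fin.castAdd 5 j)) (1:ℝ) : Fin 6 → ℝ)) (Matrix.of fun (e : Fin 6) (j : Fin 3) => ((if ((![(0, 1), (0, 2), (0, 3), (1, 2), (1, 3), (2, 3)] : Fin 6 → Fin 4 × Fin 4) e).1 = j.succ then (1:ℝ) else 0) - (if ((![(0, 1), (0, 2), (0, 3), (1, 2), (1, 3), (2, 3)] : Fin 6 → Fin 4 × Fin 4) e).2 = j.succ then (1:ℝ) else 0))) (-(Matrix.of fun (e : Fin 6) (j : Fin 3) => ((if ((![(0, 1), (0, 2), (0, 3), (1, 2), (1, 3), (2, 3)] : Fin 6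 → Fin 4 × Fin 4) e).1 = j.succ then (1:ℝ) else 0) - (if ((![(0, 1), (0, 2), (0, 3), (1, 2), (1, 3), (2, 3)] : Fin 6 → Fin 4 × Fin 4) e).2 = j.succ then (1:ℝ) else 0))).transpose) (0 : Matrix (Fin 3) (Fin 3) ℝ)).det) ^ 2) * (1 / ((Matrix.fromBlocks (Matrix.diagonal (Fin.snoc (fun j : Fin 5 => z (Fin.natAdd 5 j)) (1:ℝ) : Fin 6 → ℝ)) (Matrix.of fun (e : Fin 6) (j : Fin 3) => ((if ((![(0, 1), (0, 2), (0, 3), (1, 2), (1, 3), (2, 3)] : Fin 6 → Fin 4 × Fin 4) e).1 = j.succ then (1:ℝ) else 0) - (if ((![(0, 1), (0, 2), (0, 3), (1, 2), (1, 3), (2, 3)] : Fin 6 → Fin 4 × Fin 4) e).2 = j.succ then (1:ℝ) else 0))) (-(Matrix.of fun (e : Fin 6) (j : Fin 3) => ((if ((![(0, 1), (0, 2), (0, 3), (1, 2), (1, 3), (2, 3)] : Fin 6 → Fin 4 × Fin 4) e).1 = j.succ then (1:ℝ) else 0) - (if ((![(0, 1), (0, 2), (0, 3), (1, 2), (1,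 3), (2, 3)] : Fin 6 → Fin 4 × Fin 4) e).2 = j.succ then (1:ℝ) else 0))).transpose) (0 : Matrix (Fin 3) (Fin 3) ℝ)).det) ^ 2)) r'.domain → Literature.NumberTheory.Transcendental.KZ.Equivalent r r'

/-- item stmt-KontsevichZagierPeriods-3567 · support · rank 9 · closed · moot by None · by planner
sources: BlochEsnaultKreimer2006, Schnetz2010, Panzer2022
[support] Duality in the dictionary: for ANY integrand shape p, ∫_(x>0) 1/p(x,1)² ~ ∫_(u>0) 1/((Π
u)·p(1/u,1))² by the single change of variables u = 1/x (for p = Ψ_G the right side is 1/Ψ̄_G², the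
dual/planar-dual polynomial; Schnetz2010 step three, Panzer2022 §4.1, BlochEsnaultKreimer2006).
[difficulty: provable-now] [difficulty: provable-now] -/
@[route_item "route-KontsevichZagierPeriods-PhiFourLaboratory"]
def CremonaIsAMove : Prop :=
  ∀ (n : ℕ) (p : (Fin (n+1) → ℝ) → ℝ) (r r' : Literature.NumberTheory.Transcendental.KZ.IntegralRep n), r.domain = {x | ∀ j, 0 < x j} → Set.EqOn r.integrand (fun x => 1 / (p (Fin.snoc x 1)) ^ 2) r.domain → r'.domain = {u | ∀ j, 0 < u j} → Set.EqOn r'.integrand (fun u => 1 / ((∏ j, u j) * p (Fin.snoc (fun j => 1 / u j) 1)) ^ 2) r'.domain → Literature.NumberTheory.Transcendental.KZ.Equivalent r r'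

/-- item stmt-KontsevichZagierPeriods-3568 · support · rank 9 · closed · moot by None · by planner
sources: Panzer2022
[support] Calibration of the INLINED Hepp bound (it certifies the inline formula is Panzer's): for
K₄ (edges (0,1),(0,2),(0,3),(1,2),(1,3),(2,3)) the flag sum equals 84 = 12·6 + 6·2 (Panzer2022 Ex.
3.3; reproduced by script this session, together with H(W₄) = 572 and H(K₄⊕₂K₄) = H(K₃,₃+e) = 3528).
[difficulty: M] [difficulty: M] -/
@[route_item "route-KontsevichZagierPeriods-PhiFourLaboratory"]
def HeppK4 : Prop :=
  (∑ c : Fin 3 → Finset (Fin 6), if ((∀ i : Fin 3, (c i).Nonempty ∧ (∀ e ∈ c i, (Matrix.of fun (p : {p // p ∈ (c i).erase e}) (v : Fin 4) => ((if ((![(0, 1), (0, 2), (0, 3), (1, 2), (1, 3), (2, 3)] : Fin 6 → Fin 4 × Fin 4) p.1).1 = v then (1:ℚ) else 0) - (if ((![(0, 1), (0, 2), (0, 3), (1, 2), (1, 3), (2, 3)] : Fin 6 → Fin 4 × Fin 4) p.1).2 = v then (1:ℚ) else 0))).rank = (Matrix.of fun (p : {p // p ∈ c i}) (v : Fin 4)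 => ((if ((![(0, 1), (0, 2), (0, 3), (1, 2), (1, 3), (2, 3)] : Fin 6 → Fin 4 × Fin 4) p.1).1 = v then (1:ℚ) else 0) - (if ((![(0, 1), (0, 2), (0, 3), (1, 2), (1, 3), (2, 3)] : Fin 6 → Fin 4 × Fin 4) p.1).2 = v then (1:ℚ) else 0))).rank) ∧ (c i).card - (Matrix.of fun (p : {p // p ∈ c i}) (v : Fin 4) => ((if ((![(0, 1), (0, 2), (0, 3), (1, 2), (1, 3), (2, 3)] : Fin 6 → Fin 4 × Fin 4) p.1).1 = v then (1:ℚ) else 0) - (if ((![(0, 1), (0, 2), (0, 3), (1, 2), (1, 3), (2, 3)] : Fin 6 → Fin 4 × Fin 4) p.1).2 = v then (1:ℚ) else 0))).rank = i.val + 1) ∧ (∀ i j : Fin 3, i < j → c i ⊂ c j) ∧ c (Fin.last 2) = Finset.univ) then ((c 0).card : ℚ) * (∏ i : Fin 2, (((c i.succ).card : ℚ) - ((c i.castSucc).card : ℚ))) / (∏ i : Fin 2, (((c i.castSucc).card : ℚ) - 2 * ((i.val : ℚ) + 1))) else 0) = 84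

/-- item stmt-KontsevichZagierPeriods-3569 · support · rank 9 · closed · moot by None · by planner
sources: KontsevichZagier2001
[support] The Target is a special case of the summit: KontsevichZagierPeriods → PhiFourSector (the
determinantal integrand is a quotient of ℚ-polynomials, positive on the orthant or identically 0, so
IsRational holds). Records the logical position of the sector. [difficulty: S] [difficulty: S] -/
@[route_item "route-KontsevichZagierPeriods-PhiFourLaboratory"]
def SectorOfSummit : Prop :=
  KontsevichZagierPeriods → PhiFourSector

/-- item stmt-KontsevichZagierPeriods-3570 · assembly · rank 1 · closed · moot by None · by planner
sources: Panzer2022, KontsevichZagier2001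
[assembly] HeppForward → TropicalLifting → PhiFourSector (trivial composition). -/
@[route_item "route-KontsevichZagierPeriods-PhiFourLaboratory"]
def Assembly : Prop :=
  HeppForward → TropicalLifting → PhiFourSector

end Summit.KontsevichZagierPeriods.KontsevichZagierPeriods.Theses.PhiFourLaboratory
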